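import Summits.QuantumFields.YangMills.Theorems.BalabanUVNodesN06L3131HLegAtPinsPhysPU
import Literature.MathematicalPhysics.QuantumFieldTheory.Balaban1983to89.B9Thm313WholeDelta2LettersAtStatePrint
import Literature.MathematicalPhysics.QuantumFieldTheory.Balaban1983to89.B9Thm312WholeStepRegular
import Literature.MathematicalPhysics.QuantumFieldTheory.Balaban1983to89.B9MultiscaleSmoothPartitionYNear

/-!
# N06 [B9] — THE ROWS-20∕21 LETTERS `LettersS3131` AT THE REGULAR STATE CLASS 𝔖₂ = (Lʲη)⁻¹·(P1′), AT THE PINS (R-generic, U-variant)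

T. Bałaban, *Propagators for lattice gauge theories in a background field*, Commun. Math. Phys. **99** (1985) 389–434
[`Balaban1985BackgroundPropagators`, "B9"], (3.128)–(3.131) p. 421–422, (3.135)–(3.138) pp. 422–423, (3.43)–(3.44) p. 398; [4] = T. Bałaban,
*Propagators and renormalization transformations for lattice gauge theories. II*, Commun. Math. Phys. **96** (1984) 223–250
[`Balaban1984PropagatorsII`], (2.51)–(2.54), (2.60)–(2.61) pp. 232–234.

LOCATED-U8 (dag-n06-l, director №272 (5)): the certificate of record displays the Δ⁽²⁾ letters `hta₂ ∕ htb₂` on the RAW class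
`𝔠⁽²⁾ → 𝔠⁽⁰⁾ ∕ 𝔠_W⁽¹⁾` — beyond print.  Print applies T = Δ′_π + Δ⁽²⁾_π only to a REGULAR state (a G₀-output with its Hölder sizes).  THIS FILE
knits, at the certificate's pins and member-uniformly, the four letters of `B9Thm312WholeStepRegular.LettersS3131` with the SOURCE the regular state
class `𝔖₂(x,U) := weightNorm (bXH x U) (rwt (geo9Y x) (−1)) _` ((P1′) class `bHZKPG (U(Γ)) wX` carried to dimension 2) and the W-target the (P2′)
class `bH13 x U`:
* `ta`, `tbH` — the certificate's derived raw letters `hta : 𝔠⁽²⁾ → 𝔠⁽⁰⁾`, `htbH : 𝔠⁽²⁾ → bH13` raised to the state source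
  (`B9Thm313WholeDelta2LettersAtStatePrint.hasMaj_state_of_raw_two`);
* `ta₂` — from the displayed `h44G` ((3.44) for G′ out of the (P1′) class), `hD2sup` ((3.137)), `h31`, `h49` (`ta2S_pins_print_of_h44G`);
* `tb₂H` — from the same and ONE displayed (3.43) member `h43Gp` of G′∇\*_U into `bH13` (`tb₂HS_pins_print_of_h43`);
all four weakened to ONE member-uniform constant `tS·(Mα₀)` and ONE rate `δS` (`htS₁ htS₂ htS₃` are the closed numeric comparisons the
certificate discharges by `le_max_…`).  NO raw-class Δ⁽²⁾ letter is consumed: the inputs are `hta htbH h44G h43Gp hD2sup h31 h49` and the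
(P1′)∕(P2′) pin axioms — all already displayed or derived in the certificate of record.

HONEST LABEL: helper toward the U8 re-leaf (row 20 of bundle F7) over dag-n06-l's S-leaf `thm312Printed_completePairMBZS(_rates)`; every member
enters as a HYPOTHESIS of printed species; count-neutral; N06 NOT discharged; K1⁹ NOT closed; nothing continuum ∕ OS ∕ mass gap ∕ Clay.
Cell `pub-ymgap` (HUMAN RULING D-0062), Track A node N06 [B9], seat `pub-ymgap-dag-n06-d` (g17), 2026-08-29.  NEW file; nothing landed is modified.
-/

noncomputable section

namespace Summit.QuantumFields.YangMills.BalabanUVNodes.N06LettersSAtPinsPU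

open Literature.MathematicalPhysics.QuantumFieldTheory.Balaban1983to89
open Literature.MathematicalPhysics.QuantumFieldTheory.Balaban1983to89.Node00 (FBondY IBondY SiteY CfgY SiteParY SiteOpY parSymY GpY GpPhysY BondOpY toKT)
open Literature.MathematicalPhysics.QuantumFieldTheory.Balaban1983to89.Node00.OpsYSectDCoords (DvcoKH DvscoKH TpicoK T2coK cR39_trBasis_pos)
open B9Thm39ReadingCoords (cR39)
open B9Thm34Ext (toB6)
open B11SectG (HasMaj BlockNorm RowSum)
open B9Thm312Whole (cNorm GeoOK)
open B9Thm312WholeClasses (cNormR rwt rwt_nonneg)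
open B9RWSums343to347Whole (Facts347)
open B9CoReadingCoords (XBK blkBK)
open B9CoReadingCoordsS (XSK sIK blkSK GcoS)
open B9CoReadingCoordsH (XHK)
open B9CoReadingCoordsTranspose (TrIdx trBasis)
open B9PinMembersKLevelV1 (MemberY geo9Y)
open B9BackgroundsKLevelV1R (RegFamY bg9YR MemOfFam)
open B9GeoLemma21KLevelV1 (geo9Y_len_pos geo9Y_dist_triangle geo9Y_dist_comm rowSum261_geo9Y)
open B9GeoNormsKLevelV1 (geo9K geo9K_dist_nonneg)
open B7Prop2SpecialUnitary (specialUnitaryUnits)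
open B9PerturbationMajorantAlgebra (Proj349Maj Thm31GpMaj hasMaj_weaken)
open B9PerturbationMajorantsAtLetters (PcoK)
open B9MultiscaleSmoothPartitionYNear (rNear dist_sIK_le_of_nearY)
open B9SmoothHolderClassP (bHZKP bHZKPG bHZPG)
open B9GradViaDivLettersTransported (taxiB taxiS)
open B9PerturbationSplitAtLetters (TaLcoK TbLcoKH Ta2LcoK Tb2LcoKH tpi_t2_splitL_of_pins)
open B9PerturbationL2Delta2 (D2coK)
open B9SmoothHolderClassPProducers (CTel CTel_nonneg CTel_mono CTel_mul)
open B9SmoothHolderClassTClosure (abs_cf_eq_nKT)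
open B9RWSums347DefiniteFaces (geo9Y_scalars exp261 facts347_exp261_geo9Y)
open B9RowSum261DefiniteFaces (rowConst261 rowConst261_nonneg rowConst261_spec_of_rowSum261)
open B9SectDSup (weightNorm)
open B6RandomWalk (HasMajorant)
open B9Thm312WholeStepRegular (LettersS3131)
open B9Thm313WholeDelta2LettersAtStatePrint (ta2S_pins_print_of_h44G tb₂HS_pins_print_of_h43 hasMaj_state_of_raw_two)
open Summit.QuantumFields.YangMills.BalabanUVNodes.N06HolderPinsGradedAtRecord (links_le_one)
open B6Prop22KLevelTorusCensusEta (nKT)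
open B6GlobalChartV1 (PV blkV1) open B6Ineq2142KLevelV1 (β lvl) open B6Geom246MultiLevelTorus (geomT)
open scoped Matrix.Norms.L2Operator

variable {N : ℕ} {d ℓ : ℕ} {hd : 1 ≤ d + 1} {hL : Odd (ℓ + 1) ∧ 1 < ℓ + 1} {b₀ b₁ : ℝ} {Mstar : ℕ}

/-- monotonicity bookkeeping: the per-member expression of `ta2S_pins_print_of_h44G` (in the member's `L ≤ ℓ + 1`) is below the closed constant.
[cite: Balaban1985BackgroundPropagators, (3.137) p.423 (bookkeeping)] -/
theorem ta2_expr_le {L Lc ws r τ rN cR B44 B₀ CP cσ θ : ℝ} (hL0 : 0 ≤ L) (hL : L ≤ Lc) (hws : 0 ≤ ws⁻¹) (hcR : 0 ≤ cR⁻¹) (hB44 : 0 ≤ B44)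
    (hB₀ : 0 ≤ B₀) (hCP : 0 ≤ CP) (hc : 0 ≤ cσ) (hθ : 0 ≤ θ) :
    θ * L ^ 2 * (ws⁻¹ * (Lc * Real.exp ((r + τ) * rN)) * L + cR⁻¹ * (ws⁻¹ * B44 * L) +
        cR⁻¹ * (B₀ * L * (CP * L ^ 2) * cσ * (ws⁻¹ * (Lc * Real.exp ((r + τ) * rN)) * L) * cσ)) * cσ ≤
      θ * (Lc ^ 2 * (ws⁻¹ * (Lc * Real.exp ((r + τ) * rN)) * Lc + cR⁻¹ * (ws⁻¹ * B44 * Lc) +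
        cR⁻¹ * (B₀ * Lc * (CP * Lc ^ 2) * cσ * (ws⁻¹ * (Lc * Real.exp ((r + τ) * rN)) * Lc) * cσ)) * cσ) := by
  have hLc : 0 ≤ Lc := hL0.trans hL
  have hE : 0 ≤ ws⁻¹ * (Lc * Real.exp ((r + τ) * rN)) := by positivity
  rw [mul_assoc θ, mul_assoc θ]
  apply mul_le_mul_of_nonneg_left _ hθ
  gcongr

/-- monotonicity-and-scaling bookkeeping for the `tb₂H` constant of `tb₂HS_pins_print_of_h43` (`CTel` is monotone and linear).
[cite: Balaban1985BackgroundPropagators, (3.43) p.398 (bookkeeping)] -/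
theorem tb2_expr_le (b : Module.Basis (TrIdx N) ℝ (Matrix (Fin N) (Fin N) ℂ)) {K K₁ t L Lc cR B43 B₀ CP cσ δ : ℝ} (hK0 : 0 ≤ K) (hK : K ≤ K₁ * t)
    (hL0 : 0 ≤ L) (hL : L ≤ Lc) (hcR : 0 ≤ cR⁻¹) (hB43 : 0 ≤ B43) (hB₀ : 0 ≤ B₀) (hCP : 0 ≤ CP) (hc : 0 ≤ cσ) :
    B43 * (cR⁻¹ * K) * cσ + CTel d ℓ b δ (CP * L * (B₀ * (cR⁻¹ * K) * cσ) * cσ) (CP * L * (B₀ * (cR⁻¹ * K) * cσ) * cσ) ≤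
      (B43 * (cR⁻¹ * K₁) * cσ + CTel d ℓ b δ (CP * Lc * (B₀ * (cR⁻¹ * K₁) * cσ) * cσ) (CP * Lc * (B₀ * (cR⁻¹ * K₁) * cσ) * cσ)) * t := by
  have hKt : 0 ≤ K₁ * t := hK0.trans hK
  have hLc : 0 ≤ Lc := hL0.trans hL
  have h1 : CP * L * (B₀ * (cR⁻¹ * K) * cσ) * cσ ≤ CP * Lc * (B₀ * (cR⁻¹ * (K₁ * t)) * cσ) * cσ := by gcongr
  have h2 := CTel_mono (d := d) (ℓ := ℓ) b (δ := δ) h1 h1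
  have h3 : B43 * (cR⁻¹ * K) * cσ ≤ B43 * (cR⁻¹ * (K₁ * t)) * cσ := by gcongr
  have h5 : CP * Lc * (B₀ * (cR⁻¹ * (K₁ * t)) * cσ) * cσ = CP * Lc * (B₀ * (cR⁻¹ * K₁) * cσ) * cσ * t := by ring
  have e := CTel_mul (d := d) (ℓ := ℓ) b δ (CP * Lc * (B₀ * (cR⁻¹ * K₁) * cσ) * cσ) (CP * Lc * (B₀ * (cR⁻¹ * K₁) * cσ) * cσ) t
  rw [h5, e] at h2
  have h4 : B43 * (cR⁻¹ * (K₁ * t)) * cσ = B43 * (cR⁻¹ * K₁) * cσ * t := by ring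
  rw [h4] at h3
  rw [add_mul]; exact add_le_add h3 h2

/-- nonnegativity bookkeeping for the per-member `ta₂` expression. [cite: Balaban1985BackgroundPropagators, (3.137) p.423 (bookkeeping)] -/
theorem ta2_expr_nonneg {L Lc ws r τ rN cR B44 B₀ CP cσ θ : ℝ} (hL0 : 0 ≤ L) (hLc : 0 ≤ Lc) (hws : 0 ≤ ws⁻¹) (hcR : 0 ≤ cR⁻¹) (hB44 : 0 ≤ B44)
    (hB₀ : 0 ≤ B₀) (hCP : 0 ≤ CP) (hc : 0 ≤ cσ) (hθ : 0 ≤ θ) :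
    0 ≤ θ * L ^ 2 * (ws⁻¹ * (Lc * Real.exp ((r + τ) * rN)) * L + cR⁻¹ * (ws⁻¹ * B44 * L) +
        cR⁻¹ * (B₀ * L * (CP * L ^ 2) * cσ * (ws⁻¹ * (Lc * Real.exp ((r + τ) * rN)) * L) * cσ)) * cσ := by
  positivity

/-- ★★★ **THE ROWS-20∕21 LETTERS AT THE REGULAR STATE CLASS, AT THE PINS** (U8 step 1): member-uniformly in `x`, for `M ≥ M_T`, `Mα₀ ≤ a₀`,
U ∈ (3.35)–(3.36): `LettersS3131 (𝔬12 x) T_a T_a₂ T_b T_b₂ 1 (H x) _ 𝔖₂(x,U) (bH13 x U) (t_S·(Mα₀)) δ_S U` with 𝔖₂(x,U) = `weightNorm (bXH x U) (rwt (geo9Y x) (−1)) _`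
((P1′) class to dimension 2): the splits at the pinned letters (`tpi_t2_splitL_of_pins`), `ta ∕ tbH` = the raw letters `hta ∕ htbH` on the state source
(`hasMaj_state_of_raw_two`), `ta₂` from `h44G hD2 h31 h49` (`ta2S_pins_print_of_h44G`), `tb₂H` from the same and `h43` (`tb₂HS_pins_print_of_h43`), all at
the common constant `t_S·(Mα₀)` (`htS₁ htS₂ htS₃`) and rate `δ_S` (`δ_S + 3σ + 3τ ≤ r ≤ min(δ₀, δ_P, δ₂, δ₄₄ − τ)`, `δ_S + σ ≤ min(δ₄₃, δ_T)`).
[cite: Balaban1985BackgroundPropagators, (3.128)–(3.131) pp.421–422, (3.135)–(3.138) pp.422–423, (3.43)–(3.44) p.398, (3.49) p.399;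
Balaban1984PropagatorsII, (2.51)–(2.54) pp.232–233, Lemma 2.1 (2.60)–(2.61) p.234] -/
theorem hLettersS_of_pinsP44_geo9Y [NeZero N] [∀ x : MemberY d ℓ hd hL b₀ b₁ Mstar, Fintype (geo9Y x).Site]
    {R₁ R₂ : RegFamY d ℓ hd hL b₀ b₁ Mstar (Matrix (Fin N) (Fin N) ℂ)} (H : MemberY d ℓ hd hL b₀ b₁ Mstar → Prop)
    (bI : ∀ x : MemberY d ℓ hd hL b₀ b₁ Mstar, FBondY x.toKIdx → IBondY x.toKIdx)
    (hlev : ∀ (x : MemberY d ℓ hd hL b₀ b₁ Mstar) (f : FBondY x.toKIdx), lvl x.hN x.D x.hk (bI x f) = (blkV1 x.hN x.D f).1.1)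
    (hβ1 : ∀ (x : MemberY d ℓ hd hL b₀ b₁ Mstar) (f : FBondY x.toKIdx), (geomT x.D).dist (β x.hN x.D x.hk (bI x f)) (blkV1 x.hN x.D f) ≤ 1)
    (hbI0 : ∀ (x : MemberY d ℓ hd hL b₀ b₁ Mstar) (f : FBondY x.toKIdx), bI x f = bI x ⟨f.src, 0⟩)
    (hGR : MemOfFam (specialUnitaryUnits (Fin N)) R₁) (c : ℝ) {M₀ a₀ : ℝ} (hM₀ : 0 ≤ M₀) {σ τ : ℝ} (hσ : 0 < σ) (hτ : 0 < τ)
    (w13 : ℝ → ℝ) (hw13₀ : ∀ s, 0 ≤ w13 s) (hw13₁ : ∀ s, w13 s ≤ 1)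
    (bH13 : ∀ x : MemberY d ℓ hd hL b₀ b₁ Mstar, (bg9YR (Matrix (Fin N) (Fin N) ℂ) (specialUnitaryUnits (Fin N)) R₁ R₂ x).Cfg → BlockNorm (toB6 (geo9Y x) 1 (H x)) (XSK (TrIdx N) x.toKIdx → ℝ))
    (hbH13 : ∀ (x : MemberY d ℓ hd hL b₀ b₁ Mstar) (U : (bg9YR (Matrix (Fin N) (Fin N) ℂ) (specialUnitaryUnits (Fin N)) R₁ R₂ x).Cfg), bH13 x U =
      letI : Fintype (geo9K x.toKIdx).Site := (inferInstance : Fintype (geo9Y x).Site);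
      bHZPG (κ := TrIdx N) x.toKIdx (trBasis N) (taxiS x.toKIdx (bg9YR (Matrix (Fin N) (Fin N) ℂ) (specialUnitaryUnits (Fin N)) R₁ R₂ x) (fun U => U) U) (R := (1 : ℝ)) (H := H x) w13 hw13₀ hw13₁)
    (wX : ℝ → ℝ) (hwX₀ : ∀ s, 0 ≤ wX s) (hwX₁ : ∀ s, wX s ≤ 1)
    (bXH : ∀ x : MemberY d ℓ hd hL b₀ b₁ Mstar, (bg9YR (Matrix (Fin N) (Fin N) ℂ) (specialUnitaryUnits (Fin N)) R₁ R₂ x).Cfg → BlockNorm (toB6 (geo9Y x) 1 (H x)) (XBK (TrIdx N) x.toKIdx → ℝ))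
    (hbXH : ∀ (x : MemberY d ℓ hd hL b₀ b₁ Mstar) (U : (bg9YR (Matrix (Fin N) (Fin N) ℂ) (specialUnitaryUnits (Fin N)) R₁ R₂ x).Cfg), bXH x U =
      letI : Fintype (geo9K x.toKIdx).Site := (inferInstance : Fintype (geo9Y x).Site);
      bHZKPG (κ := TrIdx N) x.toKIdx (trBasis N) (taxiB x.toKIdx (bg9YR (Matrix (Fin N) (Fin N) ℂ) (specialUnitaryUnits (Fin N)) R₁ R₂ x) (fun U => U) U) (R := (1 : ℝ)) (H := H x) wX hwX₀ hwX₁)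
    {s44 : ℝ} (hs440 : 0 < s44) (hs441 : s44 < 1) (hwX44 : 0 < wX s44)
    (𝔬12 : ∀ x : MemberY d ℓ hd hL b₀ b₁ Mstar, B9Thm312Whole.Ops (geo9Y x) (bg9YR (Matrix (Fin N) (Fin N) ℂ) (specialUnitaryUnits (Fin N)) R₁ R₂ x) (XBK (TrIdx N) x.toKIdx) (XBK (TrIdx N) x.toKIdx) (XHK (TrIdx N) x.toKIdx) (XSK (TrIdx N) x.toKIdx))
    (hblk12 : ∀ x : MemberY d ℓ hd hL b₀ b₁ Mstar, (𝔬12 x).blk = blkBK x.toKIdx (bI x))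
    (Δ2 : ∀ x : MemberY d ℓ hd hL b₀ b₁ Mstar, BondOpY (Matrix (Fin N) (Fin N) ℂ) x.toKIdx)
    (hTpico12 : ∀ (x : MemberY d ℓ hd hL b₀ b₁ Mstar) (U : (bg9YR (Matrix (Fin N) (Fin N) ℂ) (specialUnitaryUnits (Fin N)) R₁ R₂ x).Cfg), (𝔬12 x).Tpi U = TpicoK x.toKIdx (trBasis N) (bg9YR (Matrix (Fin N) (Fin N) ℂ) (specialUnitaryUnits (Fin N)) R₁ R₂ x) (fun U => U) (parSymY x.toKIdx) (GpPhysY x.toKIdx (parSymY x.toKIdx)) U)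
    (hT2co12 : ∀ (x : MemberY d ℓ hd hL b₀ b₁ Mstar) (U : (bg9YR (Matrix (Fin N) (Fin N) ℂ) (specialUnitaryUnits (Fin N)) R₁ R₂ x).Cfg) , (𝔬12 x).T2 U = T2coK x.toKIdx (trBasis N) (bg9YR (Matrix (Fin N) (Fin N) ℂ) (specialUnitaryUnits (Fin N)) R₁ R₂ x) (fun U => U) (parSymY x.toKIdx) (GpPhysY x.toKIdx (parSymY x.toKIdx)) (Δ2 x) U)
    (hDvco12 : ∀ (x : MemberY d ℓ hd hL b₀ b₁ Mstar) (U : (bg9YR (Matrix (Fin N) (Fin N) ℂ) (specialUnitaryUnits (Fin N)) R₁ R₂ x).Cfg), (𝔬12 x).Dv U = DvcoKH x.toKIdx (trBasis N) (bg9YR (Matrix (Fin N) (Fin N) ℂ) (specialUnitaryUnits (Fin N)) R₁ R₂ x) (fun U => U) U)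
    {B₀ δ₀ CP δP θ₂ δ₂ B44 δ44 B43 δ43 tA δT r δS : ℝ} (hB₀ : 0 ≤ B₀) (hCP : 0 ≤ CP) (hθ₂ : 0 ≤ θ₂) (hB44 : 0 ≤ B44) (hB43 : 0 ≤ B43) (htA : 0 ≤ tA)
    (hr : 0 ≤ r) (hr₀ : r ≤ δ₀) (hrP : r ≤ δP) (hr₂ : r ≤ δ₂) (hr44 : r + τ ≤ δ44) (hδS : 0 ≤ δS) (hbud : δS + 3 * σ + 3 * τ ≤ r)
    (hbud43 : δS + σ ≤ δ43) (hbudT : δS + σ ≤ δT) {tS : ℝ}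
    (htS₁ : tA * ((wX s44)⁻¹ * ((((ℓ + 1 : ℕ) : ℝ)) * Real.exp ((δS + τ) * (rNear d ℓ + 1))) * (((ℓ + 1 : ℕ) : ℝ))) * rowConst261 (@geo9Y d ℓ hd hL b₀ b₁ Mstar) σ ≤ tS)
    (htS₂ : θ₂ * ((((ℓ + 1 : ℕ) : ℝ)) ^ 2 * (((wX s44)⁻¹ * ((((ℓ + 1 : ℕ) : ℝ)) * Real.exp ((r + τ) * (rNear d ℓ + 1))) * (((ℓ + 1 : ℕ) : ℝ))) + (cR39 (trBasis N))⁻¹ * ((wX s44)⁻¹ * B44 * (((ℓ + 1 : ℕ) : ℝ))) + (cR39 (trBasis N))⁻¹ * (B₀ * (((ℓ + 1 : ℕ) : ℝ)) * (CP * (((ℓ + 1 : ℕ) : ℝ)) ^ 2) * (rowConst261 (@geo9Y d ℓ hd hL b₀ b₁ Mstar) σ) * ((wX s44)⁻¹ * ((((ℓ + 1 : ℕ) : ℝ)) * Real.exp ((r + τ) * (rNear d ℓ + 1))) * (((ℓ + 1 : ℕ) : ℝ))) * (rowConst261 (@geo9Y d ℓ hd hL b₀ b₁ Mstar) σ)))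 * (rowConst261 (@geo9Y d ℓ hd hL b₀ b₁ Mstar) σ)) ≤ tS)
    (htS₃ : B43 * ((cR39 (trBasis N))⁻¹ * (θ₂ * ((((ℓ + 1 : ℕ) : ℝ)) ^ 2 * (((wX s44)⁻¹ * ((((ℓ + 1 : ℕ) : ℝ)) * Real.exp ((r + τ) * (rNear d ℓ + 1))) * (((ℓ + 1 : ℕ) : ℝ))) + (cR39 (trBasis N))⁻¹ * ((wX s44)⁻¹ * B44 * (((ℓ + 1 : ℕ) : ℝ))) + (cR39 (trBasis N))⁻¹ * (B₀ * (((ℓ + 1 : ℕ) : ℝ)) * (CP * (((ℓ + 1 : ℕ) : ℝ)) ^ 2) * (rowConst261 (@geo9Y d ℓ hd hL b₀ b₁ Mstar) σ) * ((wX s44)⁻¹ * ((((ℓ + 1 : ℕ) : ℝ)) * Real.exp ((r + τ) * (rNear d ℓ + 1))) * (((ℓ + 1 : ℕ) : ℝ))) * (rowConst261 (@geo9Y d ℓ hd hL b₀ b₁ Mstar) σ))) * (rowConst261 (@geo9Y d ℓ hd hL b₀ b₁ Mstar) σ)))) * rowConst261 (@geo9Y d ℓ hd hL b₀ b₁ Mstar)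 σ +
      CTel d ℓ (trBasis N) δS
        (CP * (((ℓ + 1 : ℕ) : ℝ)) * (B₀ * ((cR39 (trBasis N))⁻¹ * (θ₂ * ((((ℓ + 1 : ℕ) : ℝ)) ^ 2 * (((wX s44)⁻¹ * ((((ℓ + 1 : ℕ) : ℝ)) * Real.exp ((r + τ) * (rNear d ℓ + 1))) * (((ℓ + 1 : ℕ) : ℝ))) + (cR39 (trBasis N))⁻¹ * ((wX s44)⁻¹ * B44 * (((ℓ + 1 : ℕ) : ℝ))) + (cR39 (trBasis N))⁻¹ * (B₀ * (((ℓ + 1 : ℕ) : ℝ)) * (CP * (((ℓ + 1 : ℕ) : ℝ)) ^ 2) * (rowConst261 (@geo9Y d ℓ hd hL b₀ b₁ Mstar) σ) * ((wX s44)⁻¹ * ((((ℓ + 1 : ℕ) : ℝ)) * Real.exp ((r + τ) * (rNear d ℓ + 1))) * (((ℓ + 1 : ℕ) : ℝ))) * (rowConst261 (@geo9Y d ℓ hd hL b₀ b₁ Mstar) σ))) * (rowConst261 (@geo9Y d ℓ hd hL b₀ b₁ Mstar) σ)))) * rowConst261 (@geo9Y d ℓ hd hL b₀ b₁ Mstar)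 σ) * rowConst261 (@geo9Y d ℓ hd hL b₀ b₁ Mstar) σ)
        (CP * (((ℓ + 1 : ℕ) : ℝ)) * (B₀ * ((cR39 (trBasis N))⁻¹ * (θ₂ * ((((ℓ + 1 : ℕ) : ℝ)) ^ 2 * (((wX s44)⁻¹ * ((((ℓ + 1 : ℕ) : ℝ)) * Real.exp ((r + τ) * (rNear d ℓ + 1))) * (((ℓ + 1 : ℕ) : ℝ))) + (cR39 (trBasis N))⁻¹ * ((wX s44)⁻¹ * B44 * (((ℓ + 1 : ℕ) : ℝ))) + (cR39 (trBasis N))⁻¹ * (B₀ * (((ℓ + 1 : ℕ) : ℝ)) * (CP * (((ℓ + 1 : ℕ) : ℝ)) ^ 2) * (rowConst261 (@geo9Y d ℓ hd hL b₀ b₁ Mstar) σ) * ((wX s44)⁻¹ * ((((ℓ + 1 : ℕ) : ℝ)) * Real.exp ((r + τ) * (rNear d ℓ + 1))) * (((ℓ + 1 : ℕ) : ℝ))) * (rowConst261 (@geo9Y d ℓ hd hL b₀ b₁ Mstar) σ))) * (rowConst261 (@geo9Y d ℓ hd hL b₀ b₁ Mstar) σ)))) * rowConst261 (@geo9Y d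 ℓ hd hL b₀ b₁ Mstar) σ) * rowConst261 (@geo9Y d ℓ hd hL b₀ b₁ Mstar) σ) ≤ tS)
    {Gp : ∀ x : MemberY d ℓ hd hL b₀ b₁ Mstar, SiteOpY (Matrix (Fin N) (Fin N) ℂ) x.toKIdx} (hGp : ∀ x : MemberY d ℓ hd hL b₀ b₁ Mstar, Gp x = GpY x.toKIdx (parSymY x.toKIdx))
    {parS : ∀ x : MemberY d ℓ hd hL b₀ b₁ Mstar, SiteParY (Matrix (Fin N) (Fin N) ℂ) x.toKIdx} (hparS : ∀ x : MemberY d ℓ hd hL b₀ b₁ Mstar, parS x = parSymY x.toKIdx)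
    (h31 : ∀ x : MemberY d ℓ hd hL b₀ b₁ Mstar, M₀ ≤ (geo9Y x).M → ∀ α₀ : ℝ, 0 < α₀ → (geo9Y x).M * α₀ ≤ a₀ → ∀ U : (bg9YR (Matrix (Fin N) (Fin N) ℂ) (specialUnitaryUnits (Fin N)) R₁ R₂ x).Cfg, (bg9YR (Matrix (Fin N) (Fin N) ℂ) (specialUnitaryUnits (Fin N)) R₁ R₂ x).Reg335 c α₀ U →
      Thm31GpMaj (g := geo9Y x) (blkSK x.toKIdx (sIK x.toKIdx (bI x))) (blkBK x.toKIdx (bI x))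
        (GcoS x.toKIdx (trBasis N) (bg9YR (Matrix (Fin N) (Fin N) ℂ) (specialUnitaryUnits (Fin N)) R₁ R₂ x) (fun U => U) (Gp x) U)
        (DvcoKH x.toKIdx (trBasis N) (bg9YR (Matrix (Fin N) (Fin N) ℂ) (specialUnitaryUnits (Fin N)) R₁ R₂ x) (fun U => U) U) (DvscoKH x.toKIdx (trBasis N) (bg9YR (Matrix (Fin N) (Fin N) ℂ) (specialUnitaryUnits (Fin N)) R₁ R₂ x) (fun U => U) U) 1 (H x) B₀ δ₀)
    (h49 : ∀ x : MemberY d ℓ hd hL b₀ b₁ Mstar, M₀ ≤ (geo9Y x).M → ∀ α₀ : ℝ, 0 < α₀ → (geo9Y x).M * α₀ ≤ a₀ → ∀ U : (bg9YR (Matrix (Fin N) (Fin N) ℂ) (specialUnitaryUnits (Fin N)) R₁ R₂ x).Cfg, (bg9YR (Matrix (Fin N) (Fin N) ℂ) (specialUnitaryUnits (Fin N)) R₁ R₂ x).Reg335 c α₀ U →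
      Proj349Maj (g := geo9Y x) (blkSK x.toKIdx (sIK x.toKIdx (bI x))) (blkBK x.toKIdx (bI x))
        (PcoK x.toKIdx (trBasis N) (bg9YR (Matrix (Fin N) (Fin N) ℂ) (specialUnitaryUnits (Fin N)) R₁ R₂ x) (fun U => U) (parS x) (Gp x) U)
        (DvcoKH x.toKIdx (trBasis N) (bg9YR (Matrix (Fin N) (Fin N) ℂ) (specialUnitaryUnits (Fin N)) R₁ R₂ x) (fun U => U) U) (DvscoKH x.toKIdx (trBasis N) (bg9YR (Matrix (Fin N) (Fin N) ℂ) (specialUnitaryUnits (Fin N)) R₁ R₂ x) (fun U => U) U) 1 (H x) CP δP)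
    (h43 : ∀ x : MemberY d ℓ hd hL b₀ b₁ Mstar, letI : Fintype (geo9K x.toKIdx).Site := (inferInstance : Fintype (geo9Y x).Site); M₀ ≤ (geo9Y x).M → ∀ α₀ : ℝ, 0 < α₀ → (geo9Y x).M * α₀ ≤ a₀ → ∀ U : (bg9YR (Matrix (Fin N) (Fin N) ℂ) (specialUnitaryUnits (Fin N)) R₁ R₂ x).Cfg, (bg9YR (Matrix (Fin N) (Fin N) ℂ) (specialUnitaryUnits (Fin N)) R₁ R₂ x).Reg335 c α₀ U →
      (bg9YR (Matrix (Fin N) (Fin N) ℂ) (specialUnitaryUnits (Fin N)) R₁ R₂ x).Reg336 c α₀ U →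
        HasMaj (cNorm 1 (H x) (𝔬12 x).blk (fun y => (geo9Y_len_pos x y).le) 0) (bH13 x U)
          (GcoS x.toKIdx (trBasis N) (bg9YR (Matrix (Fin N) (Fin N) ℂ) (specialUnitaryUnits (Fin N)) R₁ R₂ x) (fun U => U) (GpY x.toKIdx (parSymY x.toKIdx)) U ∘ₗ DvscoKH x.toKIdx (trBasis N) (bg9YR (Matrix (Fin N) (Fin N) ℂ) (specialUnitaryUnits (Fin N)) R₁ R₂ x) (fun U => U) U)
          (fun a a' => B43 * Real.exp (-(δ43 * (geo9Y x).dist a a'))))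
    (h44G : ∀ x : MemberY d ℓ hd hL b₀ b₁ Mstar, letI : Fintype (geo9K x.toKIdx).Site := (inferInstance : Fintype (geo9Y x).Site); M₀ ≤ (geo9Y x).M → ∀ α₀ : ℝ, 0 < α₀ → (geo9Y x).M * α₀ ≤ a₀ → ∀ U : (bg9YR (Matrix (Fin N) (Fin N) ℂ) (specialUnitaryUnits (Fin N)) R₁ R₂ x).Cfg, (bg9YR (Matrix (Fin N) (Fin N) ℂ) (specialUnitaryUnits (Fin N)) R₁ R₂ x).Reg335 c α₀ U → (bg9YR (Matrix (Fin N) (Fin N) ℂ) (specialUnitaryUnits (Fin N)) R₁ R₂ x).Reg336 c α₀ U →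
      HasMaj (bHZKP (κ := TrIdx N) x.toKIdx (trBasis N) (taxiB x.toKIdx (bg9YR (Matrix (Fin N) (Fin N) ℂ) (specialUnitaryUnits (Fin N)) R₁ R₂ x) (fun U => U) U) (R := (1 : ℝ)) (H := H x) hs440.le hs441.le) (cNorm 1 (H x) (𝔬12 x).blk (fun y => (geo9Y_len_pos x y).le) 1)
        ((𝔬12 x).Dv U ∘ₗ GcoS x.toKIdx (trBasis N) (bg9YR (Matrix (Fin N) (Fin N) ℂ) (specialUnitaryUnits (Fin N)) R₁ R₂ x) (fun U => U) (GpY x.toKIdx (parSymY x.toKIdx)) U ∘ₗ (𝔬12 x).Dvstar U) (fun a b => B44 * Real.exp (-(δ44 * (geo9Y x).dist a b))))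
    (hDvsco12 : ∀ (x : MemberY d ℓ hd hL b₀ b₁ Mstar) (U : (bg9YR (Matrix (Fin N) (Fin N) ℂ) (specialUnitaryUnits (Fin N)) R₁ R₂ x).Cfg), (𝔬12 x).Dvstar U = DvscoKH x.toKIdx (trBasis N) (bg9YR (Matrix (Fin N) (Fin N) ℂ) (specialUnitaryUnits (Fin N)) R₁ R₂ x) (fun U => U) U)
    (hD2 : ∀ x : MemberY d ℓ hd hL b₀ b₁ Mstar, M₀ ≤ (geo9Y x).M → ∀ α₀ : ℝ, 0 < α₀ → (geo9Y x).M * α₀ ≤ a₀ → ∀ U : (bg9YR (Matrix (Fin N) (Fin N) ℂ) (specialUnitaryUnits (Fin N)) R₁ R₂ x).Cfg, (bg9YR (Matrix (Fin N) (Fin N) ℂ) (specialUnitaryUnits (Fin N)) R₁ R₂ x).Reg335 c α₀ U →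
      (bg9YR (Matrix (Fin N) (Fin N) ℂ) (specialUnitaryUnits (Fin N)) R₁ R₂ x).Reg336 c α₀ U → HasMajorant (g := toB6 (geo9Y x) 1 (H x)) (𝔬12 x).blk (D2coK x.toKIdx (trBasis N) (bg9YR (Matrix (Fin N) (Fin N) ℂ) (specialUnitaryUnits (Fin N)) R₁ R₂ x) (fun U => U) (Δ2 x) U) (fun (a b : (geo9Y x).Site) => θ₂ * ((geo9Y x).M * α₀) * ((geo9Y x).len a ^ 2)⁻¹ * Real.exp (-(δ₂ * (geo9Y x).dist a b))))
    (hta : ∀ x : MemberY d ℓ hd hL b₀ b₁ Mstar, M₀ ≤ (geo9Y x).M → ∀ α₀ : ℝ, 0 < α₀ → (geo9Y x).M * α₀ ≤ a₀ → ∀ U : (bg9YR (Matrix (Fin N) (Fin N) ℂ) (specialUnitaryUnits (Fin N)) R₁ R₂ x).Cfg, (bg9YR (Matrix (Fin N) (Fin N) ℂ) (specialUnitaryUnits (Fin N)) R₁ R₂ x).Reg335 c α₀ U →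
      (bg9YR (Matrix (Fin N) (Fin N) ℂ) (specialUnitaryUnits (Fin N)) R₁ R₂ x).Reg336 c α₀ U → HasMaj (cNorm 1 (H x) (𝔬12 x).blk (fun y => (geo9Y_len_pos x y).le) 2) (cNorm 1 (H x) (𝔬12 x).blk (fun y => (geo9Y_len_pos x y).le) 0) (TaLcoK x.toKIdx (trBasis N) (bg9YR (Matrix (Fin N) (Fin N) ℂ) (specialUnitaryUnits (Fin N)) R₁ R₂ x) (fun U => U) (parSymY x.toKIdx) (GpPhysY x.toKIdx (parSymY x.toKIdx)) U) (fun a a' => tA * ((geo9Y x).M * α₀) * Real.exp (-(δT * (geo9Y x).dist a a'))))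
    (htbH : ∀ x : MemberY d ℓ hd hL b₀ b₁ Mstar, M₀ ≤ (geo9Y x).M → ∀ α₀ : ℝ, 0 < α₀ → (geo9Y x).M * α₀ ≤ a₀ → ∀ U : (bg9YR (Matrix (Fin N) (Fin N) ℂ) (specialUnitaryUnits (Fin N)) R₁ R₂ x).Cfg, (bg9YR (Matrix (Fin N) (Fin N) ℂ) (specialUnitaryUnits (Fin N)) R₁ R₂ x).Reg335 c α₀ U →
      (bg9YR (Matrix (Fin N) (Fin N) ℂ) (specialUnitaryUnits (Fin N)) R₁ R₂ x).Reg336 c α₀ U → HasMaj (cNorm 1 (H x) (𝔬12 x).blk (fun y => (geo9Y_len_pos x y).le) 2) (bH13 x U) (TbLcoKH x.toKIdx (trBasis N) (bg9YR (Matrix (Fin N) (Fin N) ℂ) (specialUnitaryUnits (Fin N)) R₁ R₂ x) (fun U => U) (parSymY x.toKIdx) (GpPhysY x.toKIdx (parSymY x.toKIdx)) U) (fun a a' => tA * ((geo9Y x).M * α₀) * Real.exp (-(δT * (geo9Y x).dist a a')))) :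
    ∃ MT : ℝ, ∀ x : MemberY d ℓ hd hL b₀ b₁ Mstar, MT ≤ (geo9Y x).M → ∀ α₀ : ℝ, 0 < α₀ → (geo9Y x).M * α₀ ≤ a₀ → ∀ U : (bg9YR (Matrix (Fin N) (Fin N) ℂ) (specialUnitaryUnits (Fin N)) R₁ R₂ x).Cfg, (bg9YR (Matrix (Fin N) (Fin N) ℂ) (specialUnitaryUnits (Fin N)) R₁ R₂ x).Reg335 c α₀ U →
      (bg9YR (Matrix (Fin N) (Fin N) ℂ) (specialUnitaryUnits (Fin N)) R₁ R₂ x).Reg336 c α₀ U →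
        LettersS3131 (𝔬12 x) (TaLcoK x.toKIdx (trBasis N) (bg9YR (Matrix (Fin N) (Fin N) ℂ) (specialUnitaryUnits (Fin N)) R₁ R₂ x) (fun U => U) (parSymY x.toKIdx) (GpPhysY x.toKIdx (parSymY x.toKIdx)))
          (Ta2LcoK x.toKIdx (trBasis N) (bg9YR (Matrix (Fin N) (Fin N) ℂ) (specialUnitaryUnits (Fin N)) R₁ R₂ x) (fun U => U) (parSymY x.toKIdx) (GpPhysY x.toKIdx (parSymY x.toKIdx)) (Δ2 x))
          (TbLcoKH x.toKIdx (trBasis N) (bg9YR (Matrix (Fin N) (Fin N) ℂ) (specialUnitaryUnits (Fin N)) R₁ R₂ x) (fun U => U) (parSymY x.toKIdx) (GpPhysY x.toKIdx (parSymY x.toKIdx)))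
          (Tb2LcoKH x.toKIdx (trBasis N) (bg9YR (Matrix (Fin N) (Fin N) ℂ) (specialUnitaryUnits (Fin N)) R₁ R₂ x) (fun U => U) (parSymY x.toKIdx) (GpPhysY x.toKIdx (parSymY x.toKIdx)) (Δ2 x)) 1 (H x) (fun y => (geo9Y_len_pos x y).le)
          (weightNorm (bXH x U) (rwt (geo9Y x) (-1)) (rwt_nonneg (fun y => (geo9Y_len_pos x y).le) (-1))) (bH13 x U) (tS * ((geo9Y x).M * α₀)) δS U := by
  obtain ⟨Mg, hFa⟩ := facts347_exp261_geo9Y (d := d) (ℓ := ℓ) (hd := hd) (hL := hL) (b₀ := b₀) (b₁ := b₁) (Mstar := Mstar) H (α := 1 / 2) (δ := 2 * τ)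
    (by norm_num) (by norm_num) (by linarith)
  obtain ⟨ML, hrow⟩ := rowConst261_spec_of_rowSum261 (rowSum261_geo9Y (d := d) (ℓ := ℓ) (hd := hd) (hL := hL) (b₀ := b₀) (b₁ := b₁) (Mstar := Mstar)) hσ
  have hc0 : (0 : ℝ) ≤ rowConst261 (@geo9Y d ℓ hd hL b₀ b₁ Mstar) σ := rowConst261_nonneg _ _
  have hτ' : (0 : ℝ) ≤ 1 / 2 * (2 * τ) := by linarith
  have hτe : (1 : ℝ) / 2 * (2 * τ) = τ := by ring
  refine ⟨max M₀ (max Mg ML), fun x hM α₀ hα ha U hU hU' => ?_⟩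
  letI : Fintype (geo9K x.toKIdx).Site := (inferInstance : Fintype (geo9Y x).Site)
  have hM0 : M₀ ≤ (geo9Y x).M := (le_max_left _ _).trans hM
  have hrowx : RowSum (toB6 (geo9Y x) 1 (H x)) σ (rowConst261 (@geo9Y d ℓ hd hL b₀ b₁ Mstar) σ) := fun y => hrow x (((le_max_right _ _).trans (le_max_right _ _)).trans hM) y
  have hFax := hFa x (((le_max_left _ _).trans (le_max_right _ _)).trans hM)
  have hG : GeoOK (geo9Y x) := ⟨geo9Y_dist_triangle x, geo9Y_dist_comm x, geo9K_dist_nonneg x.toKIdx, geo9Y_len_pos x⟩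
  have hN : 0 < N := Nat.pos_of_ne_zero (NeZero.ne N)
  have hcR : 0 < cR39 (trBasis N) := cR39_trBasis_pos hN
  have hθ : 0 ≤ (geo9Y x).M * α₀ := mul_nonneg (hM₀.trans hM0) hα.le
  have hcf := abs_cf_eq_nKT x.toKIdx x.hcfk
  have hNr : ∀ (y : IBondY x.toKIdx) (z : SiteY x.toKIdx), B9MultiscaleSmoothPartitionY.NearY x.toKIdx y z → (geo9K x.toKIdx).dist y (sIK x.toKIdx (bI x) z) ≤ rNear d ℓ + 1 :=
    fun y z h => dist_sIK_le_of_nearY x.toKIdx (hβ1 x) h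
  have hLx : (geo9Y x).L ≤ (((ℓ + 1 : ℕ) : ℝ)) := (geo9Y_scalars x).2.1
  have hL0 : 0 ≤ (geo9Y x).L := le_trans zero_le_one hFax.one_le_L
  have hi : 0 ≤ (cR39 (trBasis N))⁻¹ := inv_nonneg.2 hcR.le
  have hws' : 0 ≤ (wX s44)⁻¹ := inv_nonneg.2 hwX44.le
  -- the pinned member facts in R5's letters
  have h31' : Thm31GpMaj (g := geo9Y x) (blkSK x.toKIdx (sIK x.toKIdx (bI x))) (blkBK x.toKIdx (bI x))
      (GcoS x.toKIdx (trBasis N) (bg9YR (Matrix (Fin N) (Fin N) ℂ) (specialUnitaryUnits (Fin N)) R₁ R₂ x) (fun U => U) (GpY x.toKIdx (parSymY x.toKIdx)) U)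
      (DvcoKH x.toKIdx (trBasis N) (bg9YR (Matrix (Fin N) (Fin N) ℂ) (specialUnitaryUnits (Fin N)) R₁ R₂ x) (fun U => U) U) (DvscoKH x.toKIdx (trBasis N) (bg9YR (Matrix (Fin N) (Fin N) ℂ) (specialUnitaryUnits (Fin N)) R₁ R₂ x) (fun U => U) U) 1 (H x) B₀ δ₀ := by
    rw [← hGp x]; exact h31 x hM0 α₀ hα ha U hU
  have h49' : Proj349Maj (g := geo9Y x) (blkSK x.toKIdx (sIK x.toKIdx (bI x))) (blkBK x.toKIdx (bI x))
      (PcoK x.toKIdx (trBasis N) (bg9YR (Matrix (Fin N) (Fin N) ℂ) (specialUnitaryUnits (Fin N)) R₁ R₂ x) (fun U => U) (parSymY x.toKIdx) (GpY x.toKIdx (parSymY x.toKIdx)) U)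
      (DvcoKH x.toKIdx (trBasis N) (bg9YR (Matrix (Fin N) (Fin N) ℂ) (specialUnitaryUnits (Fin N)) R₁ R₂ x) (fun U => U) U) (DvscoKH x.toKIdx (trBasis N) (bg9YR (Matrix (Fin N) (Fin N) ℂ) (specialUnitaryUnits (Fin N)) R₁ R₂ x) (fun U => U) U) 1 (H x) CP δP := by
    rw [← hGp x, ← hparS x]; exact h49 x hM0 α₀ hα ha U hU
  have hD2x := hD2 x hM0 α₀ hα ha U hU hU'
  have h44x := h44G x hM0 α₀ hα ha U hU hU'
  have h43x := h43 x hM0 α₀ hα ha U hU hU'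
  have htax := hta x hM0 α₀ hα ha U hU hU'
  have htbx := htbH x hM0 α₀ hα ha U hU hU'
  rw [hDvco12 x U, hDvsco12 x U] at h44x
  rw [hblk12 x] at hD2x h44x h43x htax htbx
  rw [hbH13 x U] at h43x htbx
  have hsplit := tpi_t2_splitL_of_pins x.toKIdx (trBasis N) (bg9YR (Matrix (Fin N) (Fin N) ℂ) (specialUnitaryUnits (Fin N)) R₁ R₂ x) (fun U => U) (parSymY x.toKIdx)
    (GpPhysY x.toKIdx (parSymY x.toKIdx)) (Δ2 x) (𝔬12 x) U (hTpico12 x U) (hT2co12 x U) (hDvco12 x U)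
  have hθ₂' : 0 ≤ θ₂ * ((geo9Y x).M * α₀) := mul_nonneg hθ₂ hθ
  have htA' : 0 ≤ tA * ((geo9Y x).M * α₀) := mul_nonneg htA hθ
  -- R5 §3: the raw letters `ta`, `tbH` on the state source (rate δS, δS + σ ≤ δT)
  have hTa := hasMaj_state_of_raw_two x.toKIdx (trBasis N) (taxiB x.toKIdx (bg9YR (Matrix (Fin N) (Fin N) ℂ) (specialUnitaryUnits (Fin N)) R₁ R₂ x) (fun U => U) U) (R₀ := (1 : ℝ)) (H₀ := H x)
    wX hwX₀ hwX₁ hG hFax hrowx hs440 hs441 hwX44 (hlev x) (hbI0 x) hNr hcf htA' hδS hbudT hτ' htax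
  have hTb := hasMaj_state_of_raw_two x.toKIdx (trBasis N) (taxiB x.toKIdx (bg9YR (Matrix (Fin N) (Fin N) ℂ) (specialUnitaryUnits (Fin N)) R₁ R₂ x) (fun U => U) U) (R₀ := (1 : ℝ)) (H₀ := H x)
    wX hwX₀ hwX₁ hG hFax hrowx hs440 hs441 hwX44 (hlev x) (hbI0 x) hNr hcf htA' hδS hbudT hτ' htbx
  -- R5 §1: `ta₂` at the state from h44G; R5 §2: `tb₂H` into bH13 from h43
  have hr44' : r + 1 / 2 * (2 * τ) ≤ δ44 := by linarith
  have hbud' : δS + 3 * σ + 3 * (1 / 2 * (2 * τ)) ≤ r := by linarith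
  have hTa2 := ta2S_pins_print_of_h44G x.toKIdx (trBasis N) (bg9YR (Matrix (Fin N) (Fin N) ℂ) (specialUnitaryUnits (Fin N)) R₁ R₂ x) (fun U => U) (parSymY x.toKIdx) (Δ2 x)
    (taxiB x.toKIdx (bg9YR (Matrix (Fin N) (Fin N) ℂ) (specialUnitaryUnits (Fin N)) R₁ R₂ x) (fun U => U) U) (R₀ := (1 : ℝ)) (H₀ := H x) wX hwX₀ hwX₁ hG hFax hrowx hcR hs440 hs441 hwX44
    (hlev x) (hbI0 x) hNr hcf h31' h49' hD2x h44x hB₀ hCP hθ₂' hB44 hc0 hσ.le hτ' hr hr₀ hrP hr₂ hr44' hδS hbud'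
  have hTb2 := tb₂HS_pins_print_of_h43 x.toKIdx (trBasis N) (bg9YR (Matrix (Fin N) (Fin N) ℂ) (specialUnitaryUnits (Fin N)) R₁ R₂ x) (fun U => U) (parSymY x.toKIdx) (Δ2 x)
    (taxiB x.toKIdx (bg9YR (Matrix (Fin N) (Fin N) ℂ) (specialUnitaryUnits (Fin N)) R₁ R₂ x) (fun U => U) U) (R₀ := (1 : ℝ)) (H₀ := H x) wX hwX₀ hwX₁ w13 hw13₀ hw13₁ hG hFax hrowx hcR
    hs440 hs441 hwX44 (hβ1 x) (hlev x) (hbI0 x) hNr hcf (links_le_one hGR x hU) h31' h49' hD2x h44x h43x hB₀ hCP hθ₂' hB44 hB43 hc0 hσ.le hτ' hr hr₀ hrP hr₂ hr44' hδS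
    hbud' hbud43
  rw [hτe] at hTa hTb hTa2 hTb2
  rw [← hblk12 x] at hTa hTa2
  rw [← hbH13 x U] at hTb hTb2
  rw [hbXH x U]
  have hL0K : 0 ≤ (geo9K x.toKIdx).L := hL0
  have hLxK : (geo9K x.toKIdx).L ≤ (((ℓ + 1 : ℕ) : ℝ)) := hLx
  have hLc0 : (0 : ℝ) ≤ (((ℓ + 1 : ℕ) : ℝ)) := Nat.cast_nonneg _
  have hK2 := (ta2_expr_le (r := r) (τ := τ) (rN := rNear d ℓ + 1) hL0K hLxK hws' hi hB44 hB₀ hCP hc0 hθ₂').trans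
    (le_of_eq (show _ = θ₂ * ((((ℓ + 1 : ℕ) : ℝ)) ^ 2 * (((wX s44)⁻¹ * ((((ℓ + 1 : ℕ) : ℝ)) * Real.exp ((r + τ) * (rNear d ℓ + 1))) * (((ℓ + 1 : ℕ) : ℝ))) + (cR39 (trBasis N))⁻¹ * ((wX s44)⁻¹ * B44 * (((ℓ + 1 : ℕ) : ℝ))) + (cR39 (trBasis N))⁻¹ * (B₀ * (((ℓ + 1 : ℕ) : ℝ)) * (CP * (((ℓ + 1 : ℕ) : ℝ)) ^ 2) * (rowConst261 (@geo9Y d ℓ hd hL b₀ b₁ Mstar) σ) * ((wX s44)⁻¹ * ((((ℓ + 1 : ℕ) : ℝ)) * Real.exp ((r + τ) * (rNear d ℓ + 1))) * (((ℓ + 1 : ℕ) : ℝ))) * (rowConst261 (@geo9Y d ℓ hd hL b₀ b₁ Mstar) σ))) * (rowConst261 (@geo9Y d ℓ hd hL b₀ b₁ Mstar) σ)) * ((geo9Y x).M * α₀) by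
      ring))
  have hK0 := ta2_expr_nonneg (L := (geo9K x.toKIdx).L) (r := r) (τ := τ) (rN := rNear d ℓ + 1) hL0K hLc0 hws' hi hB44 hB₀ hCP hc0 hθ₂'
  have hK3 := (tb2_expr_le (d := d) (ℓ := ℓ) (trBasis N) (δ := δS) hK0 hK2 hL0K hLxK hi hB43 hB₀ hCP hc0).trans (mul_le_mul_of_nonneg_right htS₃ hθ)
  have hK1 : tA * ((geo9Y x).M * α₀) * ((wX s44)⁻¹ * ((((ℓ + 1 : ℕ) : ℝ)) * Real.exp ((δS + τ) * (rNear d ℓ + 1))) * (geo9K x.toKIdx).L) *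
      rowConst261 (@geo9Y d ℓ hd hL b₀ b₁ Mstar) σ ≤ tS * ((geo9Y x).M * α₀) :=
    calc _ ≤ tA * ((geo9Y x).M * α₀) * ((wX s44)⁻¹ * ((((ℓ + 1 : ℕ) : ℝ)) * Real.exp ((δS + τ) * (rNear d ℓ + 1))) * (((ℓ + 1 : ℕ) : ℝ))) * rowConst261 (@geo9Y d ℓ hd hL b₀ b₁ Mstar) σ := by gcongr
      _ = tA * ((wX s44)⁻¹ * ((((ℓ + 1 : ℕ) : ℝ)) * Real.exp ((δS + τ) * (rNear d ℓ + 1))) * (((ℓ + 1 : ℕ) : ℝ))) * rowConst261 (@geo9Y d ℓ hd hL b₀ b₁ Mstar) σ * ((geo9Y x).M * α₀) := by ring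
      _ ≤ tS * ((geo9Y x).M * α₀) := mul_le_mul_of_nonneg_right htS₁ hθ
  exact
    { split := hsplit.1
      split₂ := hsplit.2
      ta := hTa.mono fun a b => mul_le_mul_of_nonneg_right hK1 (Real.exp_nonneg _)
      ta₂ := hTa2.mono fun a b => mul_le_mul_of_nonneg_right (hK2.trans (mul_le_mul_of_nonneg_right htS₂ hθ)) (Real.exp_nonneg _)
      tbH := hTb.mono fun a b => mul_le_mul_of_nonneg_right hK1 (Real.exp_nonneg _)
      tb₂H := hTb2.mono fun a b => mul_le_mul_of_nonneg_right hK3 (Real.exp_nonneg _) }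

end Summit.QuantumFields.YangMills.BalabanUVNodes.N06LettersSAtPinsPU

end
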